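import Summits.HodgeConjecture.HodgeConjecture.Theses.EndoscopicMiddleDegree
import Literature.AlgebraicGeometry.HodgeTheory.HolomorphicBundleChernCharacter
import Literature.AlgebraicGeometry.HodgeTheory.HodgeTypePullback
import Literature.AlgebraicGeometry.HodgeTheory.HodgeModelExistence
import Literature.AlgebraicGeometry.HodgeTheory.AlgebraicClassesExteriorProduct
import Literature.AlgebraicGeometry.HodgeTheory.PulledBackAlgebraicClasses
import Literature.Geometry.Kaehler.ChernCharacterPullback
import HarnessLib

/-!
# Route EndoscopicMiddleDegree · `CupProductAlgebraic` (stmt-HodgeConjecture-14350) from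
# Voisin I Thm. 11.32 ⊗ ℂ (Chern characters span the algebraic classes)

The item `CupProductAlgebraic` — `Nˡ H²ˡ ∪ Nᵏ H²ᵏ ⊆ N^{l+k} H^{2(l+k)}` on every smooth projective
`X/ℂ` (Voisin II Prop. 9.20 on the coniveau carrier `algebraicClasses`) — is reduced in the tree
to Prop. 9.21 (i) for the diagonal, `Δ^*(N^p H^{2p}(X × X)) ⊆ N^p H^{2p}(X)`
(`cupProduct_mem_algebraicClasses_of_forall_map_diagonal`, file `AlgebraicClassesExteriorProduct`),
whose printed proof is Chow's moving lemma ("a theory, not a lemma" on the tree's carriers: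
purity, a constructed cycle class through rational equivalence, Roberts' moving lemma).

This file PROVES that pull-back hypothesis — for EVERY `ℂ`-morphism `f : Y ⟶ X` of smooth
projective varieties (both dimension orders; in particular for every diagonal, and for the
hypothesis `PBᵖ = algebraicClasses` of `HodgeTheory/PulledBackAlgebraicClasses`) — from the tree's
named fact `span_holomorphicBundleChernCharacter_eq_algebraicClasses` (Voisin I, Thm. 11.32 ⊗ ℂ:
on a smooth projective `X` the `ℂ`-span of the Chern characters `ch_p(E)` of holomorphic vector
bundles equals `algebraicClasses X p`), by the NATURALITY of Chern–Weil forms, proved in the tree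
(`Geometry/Kaehler/ChernCharacterPullback`: `f⁻¹V`, `f^*D`, `ch_p(f⁻¹V, f^*D) = f^* ch_p(V, D)`),
transported through Hodge models exactly as Hodge types are in `HodgeTypePullback`
(`HodgeModel.induce`, the comparison family induced on `dim Y`-manifolds): `f^* ch_p(E) = ch_p(f^*E)`
(Kobayashi, Ch. II §1 Axiom 2), so `f^*(span ch_p) ⊆ span ch_p`, i.e. `f^*(Nᵖ H²ᵖ(X)) ⊆ Nᵖ H²ᵖ(Y)`.
Hence (`cupProductAlgebraic_of_span_chernCharacter`): Thm. 11.32 ⊗ ℂ and the existence of Hodge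
models (`nonempty_hodgeModel`, itself reduced in the tree to de Rham's theorem and the Hodge
decomposition) imply `CupProductAlgebraic`. CONDITIONAL result: the item is not closed by this
file; it records that the item's algebro-geometric input is subsumed by the K-theoretic named fact.
Prover seat prover-pitem-stmt-HodgeConjecture-14350-0.
-/

noncomputable section

namespace Summit.HodgeConjecture.HodgeConjecture.Theorems.EndoscopicMiddleDegree

open scoped Manifold ContDiff
open CategoryTheory MonoidalCategory
open Literature.AlgebraicGeometry Literature.AlgebraicGeometry.HodgeTheory
open Literature.AlgebraicTopology.SingularHomology (singularCohomology)
open Literature.NumberTheory.Transcendental (complexDeRhamCohomology mem_cclosedSmoothForms)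
open Literature.Geometry.Kaehler

variable {m n : ℕ} {Y X : Motives.SchemeOver ℂ}

/-- **Naturality of the Chern character sets under `f^*`** (Kobayashi, Ch. II §1 Axiom 2,
`c(f⁻¹E) = f^* c(E)`; Voisin I §7.3.2 / Serre GAGA §2 n°5 for the holomorphy of `f^an`): if
`c ∈ H²ᵖ(X(ℂ); ℂ)` is a `p`-th Chern character of the cocycle `V` on the Hodge model `A` of `X`
(witnessed by a connection `D` and a global form `θ = ch_p(V, D)` with `A.pullback c = A.deRham[θ]`),
then `f^* c` is a `p`-th Chern character of the induced cocycle `(f^an)⁻¹V` on the Hodge model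
`B.induce A hmn` of `Y` (`dim Y ≤ dim X`), witnessed by `(f^an)^*D` and `(f^an)^*θ`: the comparison
of `B.induce A hmn` is the family induced from `A.deRham`, natural along `f^an ∘ π : Cyl Y^an → X^an`.
[cite: Kobayashi1987, Ch. II §1 Axiom 2 and §2 (2.21)] [cite: SerreGAGA1956, §2 n°5] -/
theorem map_mem_chernCharacterSet_induce (A : HodgeModel n X) (B : HodgeModel m Y) (hmn : m ≤ n)
    (hY : Motives.IsSmoothProjective m Y) (hX : Motives.IsSmoothProjective n X) (f : Y ⟶ X)
    {ι : Type} {r : ℕ} {V : SmoothComplexVectorBundle ι A.model A.carrier r} {p : ℕ}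
    {c : complexBetti X (2 * p)} (hc : c ∈ A.chernCharacterSet V p) :
    complexBetti.map f (2 * p) c ∈
      (B.induce A hmn).chernCharacterSet
        (V.pullback (HodgeModel.anMap A B f) (HodgeModel.contMDiff_anMap A B f hY hX)) p := by
  obtain ⟨D, θ, hs, hcl, hθ, hwc⟩ := hc
  have hfan : ContMDiff 𝓘(ℝ, B.model) 𝓘(ℝ, A.model) ∞ (HodgeModel.anMap A B f) :=
    HodgeModel.contMDiff_anMap A B f hY hX
  have hmem := Literature.NumberTheory.Transcendental.pullback_mem_closedSmoothForms hfan
    ((mem_closedSmoothForms_iff θ).2 ⟨hs, hcl⟩)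
  refine ⟨D.pullback _ hfan, θ.pullback 𝓘(ℝ, B.model) (HodgeModel.anMap A B f), hmem.1, hmem.2,
    hθ.pullback hfan, ?_⟩
  symm
  change HodgeModel.inducedIso A B hmn B.carrier (2 * p)
      (complexDeRhamCohomology.map B.model hfan (2 * p)
        (complexDeRhamCohomology.mk A.model A.carrier (2 * p) ⟨θ, mem_cclosedSmoothForms hs hcl⟩)) =
    B.pullback (2 * p) (complexBetti.map f (2 * p) c)
  rw [HodgeModel.inducedIso_apply, ← LinearMap.comp_apply
      (g := complexDeRhamCohomology.map B.model hfan (2 * p)),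
    ← complexDeRhamCohomology.map_comp hfan (contMDiff_cylFst A B hmn B.carrier),
    A.deRham_isNatural (Cyl A B hmn B.carrier) A.carrier _
      (hfan.comp (contMDiff_cylFst A B hmn B.carrier)) (2 * p) _,
    ← hwc, complexBetti.map, ← HodgeModel.map_anMap_pullback]
  change ((singularCohomology.map ℂ ℂ _ (2 * p) ≫ singularCohomology.map ℂ ℂ _ (2 * p)).hom _) = _
  rw [← singularCohomology.map_comp]
  rfl

/-- **`f^*` maps Chern characters of holomorphic bundles on `X^an` to Chern characters of
holomorphic bundles on `Y^an`** (`f^an` is holomorphic, so `(f^an)⁻¹V` is a holomorphic cocycle;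
Kobayashi Ch. I §1, Ch. II §1 Axiom 2). [cite: Kobayashi1987, Ch. II §1 Axiom 2]
[cite: SerreGAGA1956, §2 n°5] -/
theorem map_mem_holomorphicBundleChernCharacter_induce (A : HodgeModel n X) (B : HodgeModel m Y)
    (hmn : m ≤ n) (hY : Motives.IsSmoothProjective m Y) (hX : Motives.IsSmoothProjective n X)
    (f : Y ⟶ X) {p : ℕ} {c : complexBetti X (2 * p)}
    (hc : c ∈ A.holomorphicBundleChernCharacter p) :
    complexBetti.map f (2 * p) c ∈ (B.induce A hmn).holomorphicBundleChernCharacter p := by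
  obtain ⟨ι, r, V, hV, hc⟩ := hc
  exact ⟨ι, r, V.pullback _ (HodgeModel.contMDiff_anMap A B f hY hX),
    hV.pullback (HodgeModel.contMDiff_anMap A B f hY hX) (HodgeModel.mdifferentiable_anMap A B f hY hX),
    map_mem_chernCharacterSet_induce A B hmn hY hX f hc⟩

/-- `f^*` maps the `ℂ`-span of the Chern characters of holomorphic bundles on `X^an` into that on
`Y^an` (linearity of `f^*`). [cite: Kobayashi1987, Ch. II §1 Axiom 2] -/
theorem map_mem_span_holomorphicBundleChernCharacter_induce (A : HodgeModel n X)
    (B : HodgeModel m Y) (hmn : m ≤ n) (hY : Motives.IsSmoothProjective m Y)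
    (hX : Motives.IsSmoothProjective n X) (f : Y ⟶ X) {p : ℕ} {c : complexBetti X (2 * p)}
    (hc : c ∈ Submodule.span ℂ (A.holomorphicBundleChernCharacter p)) :
    complexBetti.map f (2 * p) c ∈
      Submodule.span ℂ ((B.induce A hmn).holomorphicBundleChernCharacter p) := by
  have h : Submodule.span ℂ (A.holomorphicBundleChernCharacter p) ≤
      (Submodule.span ℂ ((B.induce A hmn).holomorphicBundleChernCharacter p)).comap
        (complexBetti.map f (2 * p)).hom :=
    Submodule.span_le.2 fun x hx ↦
      Submodule.subset_span (map_mem_holomorphicBundleChernCharacter_induce A B hmn hY hX f hx)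
  exact h hc

/-- **Pull-backs preserve algebraic classes, granted Voisin I Thm. 11.32 ⊗ ℂ** (Voisin II
Prop. 9.21 (i) "`i^* cl(Z) = cl(i^* Z)`" / Fulton Cor. 19.2 (b) on the coniveau carrier, for
`dim Y ≤ dim X`): if the `ℂ`-span of the Chern characters of holomorphic bundles is
`algebraicClasses` on every smooth projective variety
(`span_holomorphicBundleChernCharacter_eq_algebraicClasses`), then for `f : Y ⟶ X` with Hodge
models `B`, `A`: `f^*(Nᵖ H²ᵖ(X(ℂ))) ⊆ Nᵖ H²ᵖ(Y(ℂ))` — the fact on `X` (model `A`), naturality of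
Chern characters, and the fact on `Y` (model `B.induce A hmn`).
[cite: VoisinHodgeI2002, Thm. 11.32] [cite: VoisinHodgeII2003, Prop. 9.21 (i)] -/
theorem map_mem_algebraicClasses_of_span_chernCharacter_of_le
    (h : span_holomorphicBundleChernCharacter_eq_algebraicClasses)
    (hY : Motives.IsSmoothProjective m Y) (hX : Motives.IsSmoothProjective n X) (B : HodgeModel m Y)
    (A : HodgeModel n X) (hmn : m ≤ n) (f : Y ⟶ X) {p : ℕ} {c : complexBetti X (2 * p)}
    (hc : c ∈ algebraicClasses X p) : complexBetti.map f (2 * p) c ∈ algebraicClasses Y p := by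
  rw [← h hX A p] at hc
  rw [← h hY (B.induce A hmn) p]
  exact map_mem_span_holomorphicBundleChernCharacter_induce A B hmn hY hX f hc

/-- **Naturality of the Chern character sets under `f^*`, `dim Y ≥ dim X`**: the same statement as
`map_mem_chernCharacterSet_induce` when the comparison is induced the other way — `c` a Chern
character in the Hodge model `A.induce B hnm` of `X` (comparison induced from `B.deRham`) pulls back
to a Chern character of `(f^an)⁻¹V` in the model `B` of `Y` itself: naturality of `B.deRham` along
`i ∘ f^an : Y^an → Cyl X^an` and `π ∘ i = id`. [cite: Kobayashi1987, Ch. II §1 Axiom 2 and §2 (2.21)]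
[cite: SerreGAGA1956, §2 n°5] -/
theorem map_mem_chernCharacterSet_of_induce (A : HodgeModel n X) (B : HodgeModel m Y) (hnm : n ≤ m)
    (hY : Motives.IsSmoothProjective m Y) (hX : Motives.IsSmoothProjective n X) (f : Y ⟶ X)
    {ι : Type} {r : ℕ} {V : SmoothComplexVectorBundle ι A.model A.carrier r} {p : ℕ}
    {c : complexBetti X (2 * p)} (hc : c ∈ (A.induce B hnm).chernCharacterSet V p) :
    complexBetti.map f (2 * p) c ∈
      B.chernCharacterSet
        (V.pullback (HodgeModel.anMap A B f) (HodgeModel.contMDiff_anMap A B f hY hX)) p := by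
  obtain ⟨D, θ, hs, hcl, hθ, hwc⟩ := hc
  change A.pullback (2 * p) c = HodgeModel.inducedIso B A hnm A.carrier (2 * p)
    (complexDeRhamCohomology.mk A.model A.carrier (2 * p) ⟨θ, mem_cclosedSmoothForms hs hcl⟩) at hwc
  rw [HodgeModel.inducedIso_apply] at hwc
  have hfan : ContMDiff 𝓘(ℝ, B.model) 𝓘(ℝ, A.model) ∞ (HodgeModel.anMap A B f) :=
    HodgeModel.contMDiff_anMap A B f hY hX
  have hmem := Literature.NumberTheory.Transcendental.pullback_mem_closedSmoothForms hfan
    ((mem_closedSmoothForms_iff θ).2 ⟨hs, hcl⟩)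
  refine ⟨D.pullback _ hfan, θ.pullback 𝓘(ℝ, B.model) (HodgeModel.anMap A B f), hmem.1, hmem.2,
    hθ.pullback hfan, ?_⟩
  symm
  change B.deRham B.carrier (2 * p)
      (complexDeRhamCohomology.map B.model hfan (2 * p)
        (complexDeRhamCohomology.mk A.model A.carrier (2 * p) ⟨θ, mem_cclosedSmoothForms hs hcl⟩)) =
    B.pullback (2 * p) (complexBetti.map f (2 * p) c)
  -- `h = i ∘ f^an : B.carrier → Cyl A.carrier`, `π ∘ h = f^an`
  have hh : ContMDiff 𝓘(ℝ, B.model) 𝓘(ℝ, B.model) ∞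
      (cylIncl B A hnm A.carrier ∘ HodgeModel.anMap A B f) :=
    (contMDiff_cylIncl B A hnm A.carrier).comp hfan
  rw [complexDeRhamCohomology.map_congr hfan ((contMDiff_cylFst B A hnm A.carrier).comp hh)
      (funext fun x ↦ rfl) (2 * p),
    complexDeRhamCohomology.map_comp (contMDiff_cylFst B A hnm A.carrier) hh, LinearMap.comp_apply,
    B.deRham_isNatural B.carrier (Cyl B A hnm A.carrier) _ hh (2 * p), complexBetti.map,
    ← HodgeModel.map_anMap_pullback, hwc]
  change ((singularCohomology.map ℂ ℂ _ (2 * p)).hom _) =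
    (singularCohomology.map ℂ ℂ _ (2 * p) ≫ singularCohomology.map ℂ ℂ _ (2 * p)).hom _
  rw [← singularCohomology.map_comp]
  rfl

/-- `f^*` maps Chern characters of holomorphic bundles in the model `A.induce B hnm` of `X` to Chern
characters of holomorphic bundles in the model `B` of `Y` (`dim Y ≥ dim X`).
[cite: Kobayashi1987, Ch. II §1 Axiom 2] [cite: SerreGAGA1956, §2 n°5] -/
theorem map_mem_holomorphicBundleChernCharacter_of_induce (A : HodgeModel n X) (B : HodgeModel m Y)
    (hnm : n ≤ m) (hY : Motives.IsSmoothProjective m Y) (hX : Motives.IsSmoothProjective n X)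
    (f : Y ⟶ X) {p : ℕ} {c : complexBetti X (2 * p)}
    (hc : c ∈ (A.induce B hnm).holomorphicBundleChernCharacter p) :
    complexBetti.map f (2 * p) c ∈ B.holomorphicBundleChernCharacter p := by
  obtain ⟨ι, r, V, hV, hc⟩ := hc
  exact ⟨ι, r, V.pullback _ (HodgeModel.contMDiff_anMap A B f hY hX),
    hV.pullback (HodgeModel.contMDiff_anMap A B f hY hX) (HodgeModel.mdifferentiable_anMap A B f hY hX),
    map_mem_chernCharacterSet_of_induce A B hnm hY hX f hc⟩

/-- `f^*` maps the `ℂ`-span of the Chern characters of holomorphic bundles in the model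
`A.induce B hnm` of `X` into that of the model `B` of `Y` (`dim Y ≥ dim X`).
[cite: Kobayashi1987, Ch. II §1 Axiom 2] -/
theorem map_mem_span_holomorphicBundleChernCharacter_of_induce (A : HodgeModel n X)
    (B : HodgeModel m Y) (hnm : n ≤ m) (hY : Motives.IsSmoothProjective m Y)
    (hX : Motives.IsSmoothProjective n X) (f : Y ⟶ X) {p : ℕ} {c : complexBetti X (2 * p)}
    (hc : c ∈ Submodule.span ℂ ((A.induce B hnm).holomorphicBundleChernCharacter p)) :
    complexBetti.map f (2 * p) c ∈ Submodule.span ℂ (B.holomorphicBundleChernCharacter p) := by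
  have h : Submodule.span ℂ ((A.induce B hnm).holomorphicBundleChernCharacter p) ≤
      (Submodule.span ℂ (B.holomorphicBundleChernCharacter p)).comap
        (complexBetti.map f (2 * p)).hom :=
    Submodule.span_le.2 fun x hx ↦
      Submodule.subset_span (map_mem_holomorphicBundleChernCharacter_of_induce A B hnm hY hX f hx)
  exact h hc

/-- **Pull-backs preserve algebraic classes, granted Voisin I Thm. 11.32 ⊗ ℂ — all dimensions**
(Voisin II Prop. 9.21 (i) / Fulton Cor. 19.2 (b) on the coniveau carrier): for every `ℂ`-morphism
`f : Y ⟶ X` of smooth projective varieties with Hodge models `B`, `A`,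
`f^*(Nᵖ H²ᵖ(X(ℂ))) ⊆ Nᵖ H²ᵖ(Y(ℂ))`. For `dim Y ≤ dim X` this is
`map_mem_algebraicClasses_of_span_chernCharacter_of_le`; for `dim Y > dim X` the fact is applied to
the model `A.induce B _` of `X` and to `B` (the fact holds in EVERY Hodge model, so — unlike for
Hodge types — no independence-of-the-model statement is needed). This is the hypothesis kept explicit
in `HodgeTheory/PulledBackAlgebraicClasses` (`PBᵖ(X) = algebraicClasses X p`), now conditional on the
K-theoretic fact only. [cite: VoisinHodgeI2002, Thm. 11.32] [cite: VoisinHodgeII2003, Prop. 9.21 (i)]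
[cite: Fulton1998, Cor. 19.2 (b)] -/
theorem map_mem_algebraicClasses_of_span_chernCharacter
    (h : span_holomorphicBundleChernCharacter_eq_algebraicClasses)
    (hY : Motives.IsSmoothProjective m Y) (hX : Motives.IsSmoothProjective n X) (B : HodgeModel m Y)
    (A : HodgeModel n X) (f : Y ⟶ X) {p : ℕ} {c : complexBetti X (2 * p)}
    (hc : c ∈ algebraicClasses X p) : complexBetti.map f (2 * p) c ∈ algebraicClasses Y p := by
  rcases le_or_gt m n with hmn | hnm
  · exact map_mem_algebraicClasses_of_span_chernCharacter_of_le h hY hX B A hmn f hc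
  · rw [← h hX (A.induce B hnm.le) p] at hc
    rw [← h hY B p]
    exact map_mem_span_holomorphicBundleChernCharacter_of_induce A B hnm.le hY hX f hc

/-- **Pull-backs along all morphisms of smooth projective varieties preserve algebraic classes,
granted Thm. 11.32 ⊗ ℂ and the existence of Hodge models** (the family form of the hypothesis of
`pulledBackAlgebraicClasses_eq_algebraicClasses_of_forall_map_mem`, `PulledBackAlgebraicClasses`).
[cite: VoisinHodgeII2003, Prop. 9.21 (i)] [cite: VoisinHodgeI2002, Thm. 11.32] -/
theorem forall_map_mem_algebraicClasses_of_span_chernCharacter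
    (h : span_holomorphicBundleChernCharacter_eq_algebraicClasses)
    (hA : ∀ (n : ℕ) (X : Motives.SchemeOver ℂ), nonempty_hodgeModel n X)
    ⦃m n : ℕ⦄ ⦃Y X : Motives.SchemeOver ℂ⦄ (hY : Motives.IsSmoothProjective m Y)
    (hX : Motives.IsSmoothProjective n X) (f : Y ⟶ X) (p : ℕ) ⦃c : complexBetti X (2 * p)⦄
    (hc : c ∈ algebraicClasses X p) : complexBetti.map f (2 * p) c ∈ algebraicClasses Y p := by
  obtain ⟨A⟩ := hA n X hX
  obtain ⟨B⟩ := hA m Y hY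
  exact map_mem_algebraicClasses_of_span_chernCharacter h hY hX B A f hc

/-- **`PBᵖ(X) = algebraicClasses X p` granted Thm. 11.32 ⊗ ℂ and Hodge models**: the hypothesis
`hpull` of `pulledBackAlgebraicClasses_eq_algebraicClasses_of_forall_map_mem`
(`HodgeTheory/PulledBackAlgebraicClasses`: pulled-back algebraic classes of a smooth projective `X`
are exactly its algebraic classes as soon as pull-backs preserve algebraic classes) is discharged by
`forall_map_mem_algebraicClasses_of_span_chernCharacter`. [cite: VoisinHodgeII2003, Prop. 9.21 (i)]
[cite: VoisinHodgeI2002, Thm. 11.32] -/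
theorem pulledBackAlgebraicClasses_eq_algebraicClasses_of_span_chernCharacter
    (h : span_holomorphicBundleChernCharacter_eq_algebraicClasses)
    (hA : ∀ (n : ℕ) (X : Motives.SchemeOver ℂ), nonempty_hodgeModel n X)
    (hX : Motives.IsSmoothProjective n X) (p : ℕ) :
    pulledBackAlgebraicClasses X p = algebraicClasses X p :=
  pulledBackAlgebraicClasses_eq_algebraicClasses_of_forall_map_mem hX fun _ _ hY g _ ha ↦
    forall_map_mem_algebraicClasses_of_span_chernCharacter h hA hX hY g p ha

/-- **The diagonal pulls algebraic classes back to algebraic classes, granted Thm. 11.32 ⊗ ℂ and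
Hodge models** (Voisin II Prop. 9.21 (i) for `Δ : V → V × V`; the hypothesis `hΔ` of
`cupProduct_mem_algebraicClasses_of_forall_map_diagonal`): `V ⊗ V` is smooth projective of
dimension `d + d` (`IsSmoothProjective.tensor_holds`), so both carry Hodge models and
`forall_map_mem_algebraicClasses_of_span_chernCharacter` applies.
[cite: VoisinHodgeII2003, proof of Prop. 9.20 and Prop. 9.21 (i)] [cite: VoisinHodgeI2002, Thm. 11.32] -/
theorem map_diagonal_mem_algebraicClasses_of_span_chernCharacter
    (h : span_holomorphicBundleChernCharacter_eq_algebraicClasses)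
    (hA : ∀ (n : ℕ) (X : Motives.SchemeOver ℂ), nonempty_hodgeModel n X)
    ⦃d : ℕ⦄ ⦃V : Motives.SchemeOver ℂ⦄ (hV : Motives.IsSmoothProjective d V) (p : ℕ)
    ⦃c : complexBetti (V ⊗ V) (2 * p)⦄ (hc : c ∈ algebraicClasses (V ⊗ V) p) :
    complexBetti.map (CartesianMonoidalCategory.lift (𝟙 V) (𝟙 V)) (2 * p) c ∈
      algebraicClasses V p :=
  forall_map_mem_algebraicClasses_of_span_chernCharacter h hA hV
    (Motives.IsSmoothProjective.tensor_holds hV hV) _ p hc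

/-- **`CupProductAlgebraic` from Voisin I Thm. 11.32 ⊗ ℂ and the existence of Hodge models**
(conditional result): `Nˡ H²ˡ ∪ Nᵏ H²ᵏ ⊆ N^{l+k} H^{2(l+k)}` on every smooth projective `X/ℂ`
follows from `a ∪ b = Δ^*(pr_1^* a ∪ pr_2^* b)`, the unconditional algebraicity of exterior
products (`cupProduct_mem_algebraicClasses_of_forall_map_diagonal`) and the diagonal pull-back
above. [cite: VoisinHodgeII2003, Prop. 9.20] [cite: VoisinHodgeI2002, Thm. 11.32] -/
theorem cupProductAlgebraic_of_span_chernCharacter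
    (h : span_holomorphicBundleChernCharacter_eq_algebraicClasses)
    (hA : ∀ (n : ℕ) (X : Motives.SchemeOver ℂ), nonempty_hodgeModel n X) :
    Summit.HodgeConjecture.HodgeConjecture.Theses.EndoscopicMiddleDegree.CupProductAlgebraic := by
  intro n X hX l k a b ha hb
  exact cupProduct_mem_algebraicClasses_of_forall_map_diagonal
    (map_diagonal_mem_algebraicClasses_of_span_chernCharacter h hA) hX l k ha hb

end Summit.HodgeConjecture.HodgeConjecture.Theorems.EndoscopicMiddleDegree

end
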